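import Mathlib
import HarnessLib
import HarnessLib.Audit
import Summits.ABC.Statement
import HarnessLib.Audit.Status.Attr

/-!
Route: RootDecompG

# Route RootDecompG — Root decomposition G (KummerQuarticDescent, lens lens-6) — abc splits at
Kummer level 4 into a uniform quartic-twist height floor c ≤ C·N₄⁵ and abc on

It suffices to show X = KummerFloor4 ∧ KummerFloorCell4. Write N₄(abc) := ∏_{p | abc, 4 ∤ v_p(abc)}
p — the 4-free
radical = the radical of the three fourth-power-free twist coefficients α, β, γ of the Kummer point
a = αu⁴, b = βv⁴,
c = γw⁴ on the twisted Fermat QUARTIC αX⁴ + βY⁴ = γZ⁴ (genus 3; Jacobian isogenous to E_{αβγ²} ×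
E_{−α²βγ} × E_{−αβ²γ},
E_D : y² = x³ + Dx, j = 1728). KummerFloor4 (the FLOOR, ε-free, integral): ∃C ∀ abc triples, c ≤
C·N₄(abc)⁵ — a
UNIFORM polynomial height bound for primitive points on the quartic twist family, exponent 5 in the
level; equivalently
the level ladder «N₄ ≤ M ⟹ c ≤ C(M)» (every fixed M a theorem modulo Faltings, kernel
`levelRung4_of_darmonGranville`;
levels 1 and {2} unconditional kernel theorems) with C(M) = C·M⁵. KummerFloorCell4 (DECLARED
RESIDUAL): ∀K, abc on the
cell {c ≤ K·N₄⁵}. Second root OR-node of lens 6 (sibling of RootDecompB at level 5, incomparable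
floors): both pieces are
consequences of abc in the kernel (`kummerFloor4_of_abc` at ε = 1/19, `kummerFloorCell4_of_abc`;
exact AND `node_iff`),
neither is known to imply it.
Lean: `Summit.ABC.ABC.Theses.RootDecompG.KummerFloor4 ∧
Summit.ABC.ABC.Theses.RootDecompG.KummerFloorCell4`

## Assembly
One line of logic: KummerFloor4 gives C₀ with c ≤ C₀·N₄⁵ for every triple, i.e. EVERY triple lies in
the cell K = C₀;
KummerFloorCell4 on that cell is abc (deciding theorem `closes` in glue.lean, 5 lines; `node_iff` in
the node file).

Rationale: WHY THIS LINE. Vojta's height inequality for the Kummer points of abc triples on Fermat curves is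
abc (BombieriGubler2006 Thm 14.4.16);
at the fixed level n = 4 the fibres of the power map are twisted Fermat quartics, the one Kummer
level whose Jacobians
split into CM ELLIPTIC curves y² = x³ + Dx (Silverman2009 §X.6), so every bounded level is decided
by classical tools:
Faltings / Darmon–Granville per twist (DarmonGranville1995 Thm 2, kernel port here), 2-isogeny
descent and
Dem'janenko–Manin where a quotient has rank ≤ 1 (Cohen2007 Ex. 13.3.3: x⁴ + y⁴ = 2), Fermat's own
descents at levels
1 and {2} (Mathlib `fermatLastTheoremFour`, `not_fermat_42`; tree
`eq_one_of_ordCompl_two_mul_eq_pow_four`) — these two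
rungs are UNCONDITIONAL kernel theorems in the node file, where the level-5 sibling needs FLT₅ +
Ribet + Darmon–Merel as
named facts. Imported: the elliptic 2-descent / canonical-height machinery on the CM family E_D (the
floor reads
ĥ(P_T) ≤ (5/4)·log N₄ + O(1) uniformly in D = αβγ²), Faltings–Darmon–Granville finiteness, Kummer
theory. The crux is
exactly the UNIFORMITY of the ladder constant in the level (kernel
`kummerFloor4_iff_quinticLadder`), an open
Lang–Vojta-type uniform height statement; no prior route types it: FermatTwistHeights (retired
not-a-thesis) had the
same dictionary but concluded PolynomialABC only and had no kernel rungs; RootDecompB is level 5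
(genus 6, Chabauty).
Workshop record (writer decomp-abc-writer-1-g0, cell decomp-abc, LADDER-abc rung 0, D-0178): this is
root node KummerQuarticDescent of lens lens-6 (NODE 2026-08-30T03:49:34Z; lens draft file
KummerQuarticDescent.lean sha256 1c0be4eb4682980343665251ae41b966bd309b2dfe52a8fa3fcdc2c944c15e69;
NODE.md sha256 476aae69ad8828e88ca7bfcaea04e0b326ba7c4581ff5c76b703f4a1fa7c5ebc), adopted as
OR-sibling RootDecompG of the root decomposition; critic CLEARED decomp-abc-crit-1-g0
2026-08-30T03:51:31Z (HOME/STATUS.md l.224): exact (node_iff), both pieces WEAKER, no EQUIV piece,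
KummerFloorCell4 = DECLARED RESIDUAL score 0 (same ruling as B's 23645), OR-sibling of RootDecompB
(floors INCOMPARABLE both ways), tally CLEARED 17 / OBJECTION 6; lens package re-emitted with the
strength disclosure 03:53:18Z (Route.md sha16 c0a890c1). abc is NOT proved by anything here — every
piece is open and strictly WEAKER than S (S ⟹ piece in the kernel), the conjunction of the pieces
gives S by `closes`.

RANKED CRUXES. #2 KummerFloor4 (crux) — there is C such that every abc triple satisfies c ≤ C ·
N₄(abc)⁵, N₄(abc) = ∏_{p | abc, 4 ∤ v_p(abc)} p (uniform polynomial height bound, exponent 5 in the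
level, for primitive points on the twisted Fermat quartics αX⁴+βY⁴=γZ⁴; every fixed level a theorem
mod Faltings, levels 1 and {2} unconditional; the crux is uniformity C(M) = C·M⁵). STRENGTH
DISCLOSURE (critic CLEARED l.224, verbatim): KF4 ⟹ PolyABC(5) in kernel
(`polyABC_five_of_kummerFloor4`, N₄ ≤ rad) — so KummerFloor4 is AT LEAST weak-polynomial-abc-hard (c
≪ rad⁵ for ALL triples, open since Stewart–Tijdeman 1986; Stewart–Yu give only exp(rad^(1/3+ε)));
sandwich PolyABC(20/19) ⟹ KF4 ⟹ PolyABC(5); Literature.Barriers.ABC.BakerMethodBounds sits INSIDE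
the crux; road = uniform Faltings / heights on the E_D family; the ATTACKABLE content is the level
ladder. [tag WEAKER (kernel kummerFloor4_of_abc at ε = 1/19; sandwich PolyABC(20/19) ⟹ KummerFloor4
⟹ PolyABC(5) in kernel — STRENGTH DISCLOSURE: at least weak-polynomial-abc(5)-hard upward, c ≪ rad⁵
for all triples open since Stewart–Tijdeman 1986; Literature.Barriers.ABC.BakerMethodBounds INSIDE
the crux; road = uniform Faltings on the CM family E_D : y² = x³ + Dx) · NEC (exact node_iff) · C→S
probe FAIL · ATTACKABLE content = the LEVEL LADDER: levels 1 and {2} UNCONDITIONAL kernel theorems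
(Fermat quartic descents; only (1,1,2); Theorems-ready KummerQuarticRungTwo.lean = T3 witness after
landing), every bounded level mod Faltings/DG(4,4,4) (levelRung4_of_darmonGranville), crux =
uniformity C·M⁵ (kummerFloor4_iff_quinticLadder) · KINSHIP vs B.KummerFloor5 (23644): INCOMPARABLE
both ways (probe) ⇒ OR-sibling root door · prior art: retired Theses/FermatTwistHeights (same
dictionary, PolynomialABC only, no rungs); critic CLEARED decomp-abc-crit-1-g0 2026-08-30T03:51:31Z]
[difficulty: open-problem] (why it might fail: an infinite family of abc triples with three
nearly-4-full coordinates and log c/log N₄ → κ > 5 (abc caps κ at 4+o(1); heuristic limsup 3; census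
max 2.73 at 1+80=81, none > 5 to c ≤ 4·10⁴) — i.e. only if abc fails badly.) [DarmonGranville1995,
BombieriGubler2006, Silverman2009, doi:10.1112/blms/27.6.513]
#3 KummerFloorCell4 (crux) — for every K and every ε > 0 there is C > 0 such that every abc triple
with c ≤ K · N₄(abc)⁵ satisfies c < C · rad(abc)^{1+ε} (abc on the cells of the floor; DECLARED
RESIDUAL; ∀K forced because the floor's constant is unknown). [DECLARED RESIDUAL · tag WEAKER-formal
(kernel kummerFloorCell4_of_abc; C→S probe FAIL) · R-EMPTY in substance (g3 census V1–V8 transfers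
stay in-cell), accepted score 0 under the same ruling as B's 23645: (a) co-piece is a fixed-exponent
floor, axis-limit ≠ S, (b) typed rungs with decided bottom + named road (2-descent /
Dem'janenko–Manin on y² = x³ + Dx), (c) hypothesis = all triples · BARRIER-class; critic CLEARED
2026-08-30T03:51:31Z] [difficulty: open-problem] (why it might fail: cannot fail unless abc fails
(kernel `kummerFloorCell4_of_abc`); in substance the cell K = 1 contains every known abc triple and
the power map t ↦ (a⁴, c⁴−a⁴, c⁴) lands triples in it heuristically — abc minus the floor, the
residual, no road claimed.) [BombieriGubler2006, StewartYu2001]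
#9 KummerQuarticRung23 (support) — every abc triple whose 4-free radical is supported in {2,3}
(every prime p ≥ 5 divides abc to an exponent ≡ 0 mod 4) has c ≤ 9 — conjecturally exactly 1+1=2,
1+2=3, 1+3=4, 1+8=9; = resolution of the finitely many {2,3}-unit twists αX⁴+βY⁴=γZ⁴ via their
elliptic quotients y²=x³+Dx (2-isogeny descent; Dem'janenko–Manin; elliptic Chabauty). ASIDE rung
(kind aside at birth): outside the cone of closes. Finite programme (lens g4/twists23-out.txt): of
the 58 {2,3}-unit twists (α ≤ β), 38 are obstructed by congruences mod one of 16, 9, 5, 13, 17, 29,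
37, 41 (kernel-decidable); 16 are u⁴+βv⁴=w⁴ — β ∈ {1,4,9,36} by FLT₄ / x⁴−y⁴≠z² (Mathlib, tree), β ∈
{2,8,18,72} by x⁴−y⁴≠2z² (tree), β ∈ {3,12,27,108} by the rank-0 congruent-number quotient y²=x³−9x
(point (βw²/u², β²v²w/u³); 3 is not congruent ⇒ torsion ⇒ v = 0), β ∈ {6,24,54,216} need a second
quotient (6 is congruent); 4 twists (1,1,2) [tree: only ±(1,1,1)], (1,2,3), (1,3,4), (1,8,9) need
their full point sets (2-descent on y² = x³ + Dx, D ∈ {18,−6,−12}, {48,−12,−36}, {648,−72,−576}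
resp.). [aside · UNDECIDED-with-test ({2,3}-twist programme per lens NODE §8: 58 twists = 38
obstructed by congruences + 16 of shape u⁴+βv⁴=w⁴ (12 closed in tree/Mathlib or mod one rank-0 fact,
4 need a second quotient) + 4 twists of the rung's own triples by 2-descent on y² = x³ + Dx); B = 9
stands: critic structured-complete search finds ONLY (1,1,2), (1,2,3), (1,3,4), (1,8,9) to c ≤ 10¹³]
[difficulty: M] (why it might fail: a fifth {2,3}-level triple with large c on a 2^i3^j-twist whose
three quotients all have positive rank (none to 4·10⁴, lens; none to c ≤ 10¹³, critic
structured-complete search q4_23_search.out @2043d65f; REQUEST to 10¹⁸ filed).) [Silverman2009,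
Cohen2007, DarmonGranville1995]

TWO-LAYER PLAN. KummerFloor4 ⟺ ∃C ∀M: LevelRung4 M with constant C·M⁵ (kernel
`kummerFloor4_iff_quinticLadder`). The decided rungs
(level 1, level {2}: kernel, unconditional), the attackable ones ({2,3}: aside KummerQuarticRung23;
{2,3,5}: 17 known
triples up to 2401 = 1 + 2400; rank-0 levels in general) and «every level mod Faltings»
(`levelRung4_of_darmonGranville`,
offered as an aside theorem) are the instrument of progress; the foreseen layer 2 of the floor is
(UniformTwistHeight4:
ĥ(P) ≤ A·log rad(D) + B for the Kummer points on E_D, D = αβγ², uniformly in the twist) →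
KummerFloor4, filed only when
a road for the uniformity exists. KummerFloorCell4: residual, nothing filed.

KILL CRITERIA. Neither crux is refutable without refuting abc (both are kernel consequences of ABC).
The route is retired `superseded`
if a route proves abc on a class containing the complement of a cell {c ≤ K·N₄⁵}, or `superseded
--by route-ABC-RootDecompB`
if the level-5 floor acquires a road first and this one does not; KummerQuarticRung23 is refuted by
one {2,3}-level abc
triple with c > 9 (finite search certifies it to any bound).

NOT DECOMPOSED YET. The uniformity sub-cruxes of KummerFloor4 (uniform canonical-height bounds on
the CM family E_D; the v = 1 Hall–Lang
stratum), the support rungs beyond {2,3}, the residual's interior (no road claimed) — layer 2,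
later.

CHEAPEST FALSIFIER. Is there ANY abc triple with c > N₄(abc)⁵ (log c/log N₄ > 5)? Local census
(g4/q4census-40000.txt sha256 a434b93a…5993,
script g4/q4census.py, 135 s): over all abc triples with c ≤ 4·10⁴ the maximum of log c/log N₄ is
2.7304 (1 + 80 = 81,
N₄ = 5), then 2.5603 (6561 + 22000 = 28561 = 13⁴, N₄ = 55), 2.3273 (81 + 1250 = 1331), 2.2885 (1 +
2400 = 2401); 8 triples
exceed 2; none exceeds 5. A {2,3}-level abc triple with c > 9 kills KummerQuarticRung23 outright
(REQUEST to census-1 for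
the ABC@home tables and a smooth-times-fourth-power enumeration to 10¹⁸).

NUMBERS. abc ⟹ c^{1−3ε} ≪ N₄⁴·(const): log c/log N₄ < 4(1+ε)/(1−3ε); floor exponent 5 = smallest
integer the ε-bookkeeping at
ε = 1/19 reaches (c⁴ < C¹⁹N₄²⁰); PolyABC(20/19) ⟹ KummerFloor4 ⟹ PolyABC(5) (kernel). Census c ≤
4·10⁴: max κ₄ 2.7304;
levels ⊆ {2}: (1,1,2) only (kernel theorem); ⊆ {2,3}: (1,2,3), (1,3,4), (1,8,9); ⊆ {2,3,5}: 17
triples, largest (1,2400,2401).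
Darmon–Granville signature (4,4,4): 1/4+1/4+1/4 = 3/4 < 1 (kernel instance 48 < 64).

DEFINITION REQUESTS. None: N₄ is inlined as `((a*b*c).primeFactors.filter (fun p => ¬ 4 ∣
(a*b*c).factorization p)).prod (fun p => p)`
(= `fourFreeRad (a*b*c)` of the node file, definitionally); `IsABCTriple`, `rad` exist
(Literature.NumberTheory.DiophantineGeometry).

Novelty: Searches (2026-08-30): lit search --hybrid "rational points on diagonal quartic curves
ax^4+by^4=cz^4 twists of Fermat quartic" (8 docs: [corpus:silverman2009 pp.282–303],
[corpus:bombieri2006 p.310/323], generic); lit search --hybrid "elliptic curve y^2 = x^3 + Dx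
two-isogeny descent rank computation" ([corpus:silverman2009 p.296–302 §X.6]); lit galaxy search
"x^4+y^4=cz^4|diagonal quartic curve|Fermat quartic" --star all (20 rows;
[galaxy:panama:346775659479119] = Cohen, Number Theory II, §13.3 Ex. 13.3.3 p.450 Dem'janenko–Manin
for x⁴+y⁴=2, ref. Grigorov–Rizov 1998 p.567; no hit on UNIFORM height bounds for the twist family);
lean search / tree: Theses/FermatTwistHeights.lean (retired), Theses/RootDecompB.lean, Literature
…Automorphic.eq_one_of_ordCompl_two_mul_eq_pow_four, darmonGranville1995_thm_2.
Nearest prior art found: in tree the retired route FermatTwistHeights (`QuarticTwistHeightBound`: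
H(P)⁴ ≤ K(δ)·rad(ABC)^{κ₄+δ} on the same quartic twists, same CM-split Jacobian and point (ACu²/v²,
AC²uw²/v³); concluded PolynomialABC only; graded new-combination; nearest print [corpus:bombieri2006
p.436] Conj. 12.5.14) and the sibling RootDecompB (level 5); in print [corpus:bombieri2006
p.481–482] Thm 14.4.16 (abc ⟺ Vojta on Fermat towers), DarmonGranville1995 Thm 2,
[corpus:cohennd-number-theory-gx59479119 p.450–451].
Delta: a root-DECIDING exact OR-node at level 4 (floor in the level currency N₄ with the abc-forced
exponent 5 + declared residual), incomparable with the level  [refs: DarmonGranville1995]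

Barriers (technique_class: vojta-height, kummer-descent, quartic-twist, 2-descent): - technique_class: vojta-height, kummer-descent, quartic-twist, 2-descent
- Literature.Barriers.ABC.BakerMethodBounds: KummerFloor4 restricted to the tower (1, 2^{4k}−1,
2^{4k}) demands N₄(2^{4k}−1) ≥ 2^{4k/5}/C, a polynomial lower bound for a 4-free radical — inside
the class linear forms in logarithms cannot reach (log c ≪ N^A only); it does not evade it by Baker;
the bet is descent/heights on the quartic twists (every bounded level is OUTSIDE: Faltings /
2-descent, no logarithmic forms).
- Literature.Barriers.ABC.EpsilonCannotBeDropped: outside — KummerFloor4 is ε-free but with exponent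
5 on N₄ ≤ rad (it implies only c ≤ C·rad⁵); KummerFloorCell4 keeps 1+ε and an ineffective C(K,ε).
- Literature.Barriers.ABC.HallExponentSharp: outside — the v = 1 stratum of the dictionary is an
integral-point statement on y² = x³ + Dx, but the floor asks exponent 5 in N₄, far weaker than
Hall's sharp exponent; no Hall-strength claim is made.
- Literature.Barriers.ABC.UniformABCDiscriminantSharp: outside — uniformity is in the LEVEL N₄ over
ℚ, not in a number-field discriminant with a log-power.
- Literature.Barriers.ABC.ExplicitABCQualityFloor: no constant-one statement with exponent ≤ 1.63 is
claimed; Reyssat's triple 2 + 3¹⁰·109 = 23⁵ has N₄ = 2·3·109·23 = 15042 and c = 6436343 ≤ 15042⁵ —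
inside the cell K = 1.
- Literature.Barriers.ABC.IUTDisputedClaim: not cited, not used.
- Negatives index: no refuted statement of ABC concerns 4-free radicals, Fermat quartic twists or
bounded-level st

History (route lifecycle, newest last):
- 2026-08-30T08:09:49Z · rev 5: informal re-worded for KummerFloor4 (planner-decomp-abc-writer-1-g4-0)
- 2026-08-30T21:38:30Z · RESIDUAL declared: LopKummerCell4 (stmt-ABC-28097) — summit-strength until shown otherwise: gate10 D-0170 bookkeeping: tribunal residual of record payload.tribunal.residual [stmt-ABC-28097]; statement untouched; (planner-decomp-abc-writer-1-g23-0)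

sub-problem: ABC · status: open · opened planner-decomp-abc-writer-1-g0-0 2026-08-30T03:55:05Z · rev 7 · ledger route-ABC-RootDecompG
GENERATED by the gate from the ledger (D-0016/17). Provers cite these decls: `theorem foo : Summit.ABC.ABC.Theses.RootDecompG.<Decl> := …` in Summits/ABC/ABC/Theorems/<Name>.lean.
-/

namespace Summit.ABC.ABC.Theses.RootDecompG

open scoped BigOperators Topology Manifold Classical MeasureTheory ProbabilityTheory Matrix InnerProductSpace ComplexConjugate ContinuousMap
open Filter Set Function TopologicalSpace MeasureTheory

attribute [summit_statement] _root_.ABC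

open Literature.Abc

/-- item stmt-ABC-27123 · crux · leaf IDEA-NEEDED · rank 2 · open · by planner
why it might fail: an infinite family of abc triples with three nearly-4-full coordinates and log c/log N₄ → κ > 5 (abc caps κ at 4+o(1); heuristic limsup 3; census max 2.73 at 1+80=81, none > 5 to c ≤ 4·10⁴) — i.e. only if abc fails badly.
sources: DarmonGranville1995, BombieriGubler2006, Silverman2009, doi:10.1112/blms/27.6.513
[crux] there is C such that every abc triple satisfies c ≤ C · N₄(abc)⁵, N₄(abc) = ∏_{p | abc, 4 ∤
v_p(abc)} p (uniform polynomial height bound, exponent 5 in the level, for primitive points on the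
twisted Fermat quartics αX⁴+βY⁴=γZ⁴; every fixed level a theorem mod Faltings, levels 1 and {2}
unconditional; the crux is uniformity C(M) = C·M⁵). STRENGTH DISCLOSURE (critic CLEARED l.224,
verbatim): KF4 ⟹ PolyABC(5) in kernel (`polyABC_five_of_kummerFloor4`, N₄ ≤ rad) — so KummerFloor4
is AT LEAST weak-polynomial-abc-hard (c ≪ rad⁵ for ALL triples, open since Stewart–Tijdeman 1986;
Stewart–Yu give only exp(rad^(1/3+ε))); sandwich PolyABC(20/19) ⟹ KF4 ⟹ PolyABC(5);
Literature.Barriers.ABC.BakerMethodBounds sits INSIDE the crux; road = uniform Faltings / heights on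
the E_D family; the ATTACKABLE content is the level ladder. [tag WEAKER (kernel kummerFloor4_of_abc
at ε = 1/19; sandwich PolyABC(20/19) ⟹ KummerFloor4 ⟹ PolyABC(5) in kernel — STRENGTH DISCLOSURE: at
least weak-polynomial-abc(5)-hard upward, c ≪ rad⁵ for all triples open since Stewart–Tijdeman 1986;
Literature.Barriers.ABC.BakerMethodBounds INSIDE the crux; road = uniform Faltings on the CM family
E_D : y² = x³ + Dx) · NEC ( -/
@[route_item "route-ABC-RootDecompG", crux (bottleneck := idea) (source := "ledger D-0171 leaf tag IDEA-NEEDED on stmt-ABC-27123, 2026-09-01")]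
def KummerFloor4 : Prop :=
  ∃ C : ℕ, ∀ a b c : ℕ, Literature.NumberTheory.DiophantineGeometry.IsABCTriple a b c → c ≤ C * ((a * b * c).primeFactors.filter (fun p => ¬ 4 ∣ (a * b * c).factorization p)).prod (fun p => p) ^ 5

/-- item stmt-ABC-27124 · crux · rank 3 · SPLIT (gen 1) into BalKummerCell4, LopKummerCell4 + glue KummerFloorCell4OfChildren · direct attempts still welcome (low priority) · by planner
why it might fail: cannot fail unless abc fails (kernel `kummerFloorCell4_of_abc`); in substance the cell K = 1 contains every known abc triple and the power map t ↦ (a⁴, c⁴−a⁴, c⁴) lands triples in it heuristically — abc minus the floor, the residual, no road claimed.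
sources: BombieriGubler2006, StewartYu2001
[crux] for every K and every ε > 0 there is C > 0 such that every abc triple with c ≤ K · N₄(abc)⁵
satisfies c < C · rad(abc)^{1+ε} (abc on the cells of the floor; DECLARED RESIDUAL; ∀K forced
because the floor's constant is unknown). [DECLARED RESIDUAL · tag WEAKER-formal (kernel
kummerFloorCell4_of_abc; C→S probe FAIL) · R-EMPTY in substance (g3 census V1–V8 transfers stay
in-cell), accepted score 0 under the same ruling as B's 23645: (a) co-piece is a fixed-exponent
floor, axis-limit ≠ S, (b) typed rungs with decided bottom + named road (2-descent /
Dem'janenko–Manin on y² = x³ + Dx), (c) hypothesis = all triples · BARRIER-class; critic CLEARED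
2026-08-30T03:51:31Z] [difficulty: open-problem] -/
@[route_item "route-ABC-RootDecompG", crux]
def KummerFloorCell4 : Prop :=
  ∀ K : ℕ, ∀ ε : ℝ, 0 < ε → ∃ C : ℝ, 0 < C ∧ ∀ a b c : ℕ, Literature.NumberTheory.DiophantineGeometry.IsABCTriple a b c → c ≤ K * ((a * b * c).primeFactors.filter (fun p => ¬ 4 ∣ (a * b * c).factorization p)).prod (fun p => p) ^ 5 → (c : ℝ) < C * ((Literature.NumberTheory.DiophantineGeometry.rad a b c : ℕ) : ℝ) ^ (1 + ε)

-- parent: KummerFloorCell4 · child (gen 1)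
/--     item stmt-ABC-28096 · crux · leaf IDEA-NEEDED · rank 301 · open
    parent: KummerFloorCell4 · by planner
    why it might fail: cannot fail unless Szpiro(6+ε) for E′: y² = x³ − 2(a−b)x² + c²x fails (kernel SexticABC ⟹ ·); as typed it is where the T_m-images (m ≥ 2) of every hit land (λ ↦ λ/m), i.e. it carries the transported generic content of the cell, priced at Szpiro, not at abc.
    sources: BombieriGubler2006, SilvermanAEC2009, Masser2002, StewartYu2001
[crux · child 1 of KummerFloorCell4 (stmt-ABC-27124) · tag WEAKER, certified AT MOST SZPIRO-CLASS:
kernel `balKummerCell_of_sexticABC : LopsidedSzpiroSplit.SexticABC → BalKummerCell 4 5` (SexticABC =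
stmt-ABC-18361, Szpiro 6+ε for the Frey 2-isogeny codomain); `Iff.rfl` to the file's `BalKummerCell
4 5`] abc with exponent 1+ε for the abc triples of the Kummer cell {c ≤ K·N₄(abc)⁵} that are
ε-BALANCED, min(a,b) > c^{1−ε} (Vojta proximity λ < ε). ‖ writer decomp-abc-writer-1-g2: lens-6 g5
KummerProximityCut (KummerProximityCut.lean sha256 bccd5fc2…, NODE-g5.md 91bdee15…, children.json
4a28e721…), child of KummerFloorCell4 (stmt-ABC-27124) in route-ABC-RootDecompG; critic CLEARED
2026-08-30T04:49:48Z (HOME/STATUS.md l.278): tag WEAKER with CLASS certificate (SexticABC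
stmt-ABC-18361 ⟹ BalTied ⟹ this, kernel; Szpiro-class, strictly below S as far as known); the ε-TIE
(same ε in min(a,b) > c^(1−ε) and in the exponent 1+ε) is LOAD-BEARING — an untied Bal(ε₁)-abc(1+ε₂)
would be the whole cell in costume (two T₂ steps from a = 1). -/
@[route_item "route-ABC-RootDecompG"]
def BalKummerCell4 : Prop :=
  ∀ K : ℕ, ∀ ε : ℝ, 0 < ε → ∃ C : ℝ, 0 < C ∧ ∀ a b c : ℕ, Literature.NumberTheory.DiophantineGeometry.IsABCTriple a b c → c ≤ K * ((a * b * c).primeFactors.filter (fun p => ¬ 4 ∣ (a * b * c).factorization p)).prod (fun p => p) ^ 5 → (c : ℝ) ^ (1 - ε) < ((min a b : ℕ) : ℝ) → (c : ℝ) < C * ((Literature.NumberTheory.DiophantineGeometry.rad a b c : ℕ) : ℝ) ^ (1 + ε)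

-- parent: KummerFloorCell4 · child (gen 1)
/--     item stmt-ABC-28097 · crux · RESIDUAL (gen 0; summit-strength until shown otherwise, D-0170) · leaf IDEA-NEEDED · rank 302 · open
    parent: KummerFloorCell4 · by planner
    why it might fail: contains every extremal abc datum (a = 1, c a prime power: λ = 1); on that class the only unconditional engine, linear forms in logs, is capped at log c ≪ rad^{1/3+ε} (Stewart–Yu) / η⁻¹exp(κ√(log R log₂R)) (Pasten 2024 Thm 1.4); Roth decides only fixed-coefficient near-k-th-power fibres, kε > 2.
    sources: BombieriGubler2006, Pasten2024, StewartYu2001, BakerWustholz2007, EvertseGyory2015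
[crux · child 2 of KummerFloorCell4 · NEW DECLARED RESIDUAL of G · tag UNDECIDED (test: a
quality-preserving transport raising λ from < ε to ≥ ε on a positive proportion of hits with images
in the cell would make it COSTUME; power maps preserve λ, binomial syzygies T_m divide it by m, β₂
raises it only on twins |a−b| ≤ c^{1−ε}); ⟸ LopsidedABC (stmt-ABC-18360, kernel
lopKummerCell_of_lopsidedABC) and ⟸ the parent cell; `Iff.rfl` to the file's `LopKummerCell 4 5`]
abc with exponent 1+ε for the abc triples of the Kummer cell {c ≤ K·N₄(abc)⁵} that are ε-LOPSIDED,
min(a,b) ≤ c^{1−ε} (λ ≥ ε). Census (complete table rad ≤ 10⁷, 5445 hits, all in the cell at K = 1):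
Lop holds 4722/5445 hits at ε = 0.1, 3076 at ε = 0.3, 1856 at ε = 1/2; 19 of the 25 top-quality hits
with λ ≥ 0.3 lie in a Roth-decided near-power-pair fibre. ≡ FULL abc on every proximity class λ ≥ ε₀
inside the cell (the hypothesis is ε-monotone: apply the statement at min(ε, ε₀)); the ε-tie is
substantive only for the Bal sibling (critic w1). ‖ writer decomp-abc-writer-1-g2: lens-6 g5
KummerProximityCut (KummerProximityCut.lean sha256 bccd5fc2…, NODE-g5.md 91bdee15…, children.json
4a28e721…), child of KummerFloorCell4 (stmt-A -/
@[route_item "route-ABC-RootDecompG"]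
def LopKummerCell4 : Prop :=
  ∀ K : ℕ, ∀ ε : ℝ, 0 < ε → ∃ C : ℝ, 0 < C ∧ ∀ a b c : ℕ, Literature.NumberTheory.DiophantineGeometry.IsABCTriple a b c → c ≤ K * ((a * b * c).primeFactors.filter (fun p => ¬ 4 ∣ (a * b * c).factorization p)).prod (fun p => p) ^ 5 → ((min a b : ℕ) : ℝ) ≤ (c : ℝ) ^ (1 - ε) → (c : ℝ) < C * ((Literature.NumberTheory.DiophantineGeometry.rad a b c : ℕ) : ℝ) ^ (1 + ε)

-- parent: KummerFloorCell4 · glue (gen 1)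
/--     item stmt-ABC-28098 · support · rank 303 · closed · proved by Summit.ABC.ABC.Theorems.rootDecompG_kummerFloorCell4OfChildren_proof (prover)
    parent: KummerFloorCell4 · GLUE: children ⟹ parent · by planner
BalKummerCell4 → LopKummerCell4 → KummerFloorCell4 — population split of the declared residual cell
{c ≤ K·N₄(abc)⁵} by the ε-TIED archimedean proximity λ = log(c/min(a,b))/log c: given K, ε take C =
max(C_Bal, C_Lop) and case on c^(1−ε) < min(a,b) (Bal) vs min(a,b) ≤ c^(1−ε) (Lop); EXACT (kernel
kummerFloorCell4_iff_children / cell4Glue in the lens-6 g5 file KummerProximityCut.lean sha256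
bccd5fc2…; writer scratch re-certification of both directions against the tree texts: folder
G5/check.lean rc 0, 0 sorry) — size S, prover port ≈ 15 lines. -/
@[route_item "route-ABC-RootDecompG"]
def KummerFloorCell4OfChildren : Prop :=
  BalKummerCell4 → LopKummerCell4 → KummerFloorCell4

-- `KummerFloorCell4OfChildren` holds: proved by `Summit.ABC.ABC.Theorems.rootDecompG_kummerFloorCell4OfChildren_proof` (its module imports this route file, so no `_holds` link can be stated here).

/-- item stmt-ABC-27125 · aside · rank 9 · open · by planner
why it might fail: a fifth {2,3}-level triple with large c on a 2^i3^j-twist whose three quotients all have positive rank (none to 4·10⁴, lens; none to c ≤ 10¹³, critic structured-complete search q4_23_search.out @2043d65f; REQUEST to 10¹⁸ filed).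
sources: Silverman2009, Cohen2007, DarmonGranville1995
[aside] every abc triple whose 4-free radical is supported in {2,3} (every prime p ≥ 5 divides abc
to an exponent ≡ 0 mod 4) has c ≤ 9 — conjecturally exactly 1+1=2, 1+2=3, 1+3=4, 1+8=9; = resolution
of the finitely many {2,3}-unit twists αX⁴+βY⁴=γZ⁴ via their elliptic quotients y²=x³+Dx (2-isogeny
descent; Dem'janenko–Manin; elliptic Chabauty). ASIDE rung (kind aside at birth): outside the cone
of closes. Finite programme (lens g4/twists23-out.txt): of the 58 {2,3}-unit twists (α ≤ β), 38 are
obstructed by congruences mod one of 16, 9, 5, 13, 17, 29, 37, 41 (kernel-decidable); 16 are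
u⁴+βv⁴=w⁴ — β ∈ {1,4,9,36} by FLT₄ / x⁴−y⁴≠z² (Mathlib, tree), β ∈ {2,8,18,72} by x⁴−y⁴≠2z² (tree),
β ∈ {3,12,27,108} by the rank-0 congruent-number quotient y²=x³−9x (point (βw²/u², β²v²w/u³); 3 is
not congruent ⇒ torsion ⇒ v = 0), β ∈ {6,24,54,216} need a second quotient (6 is congruent); 4
twists (1,1,2) [tree: only ±(1,1,1)], (1,2,3), (1,3,4), (1,8,9) need their full point sets
(2-descent on y² = x³ + Dx, D ∈ {18,−6,−12}, {48,−12,−36}, {648,−72,−576} resp.). [aside ·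
UNDECIDED-with-test ({2,3}-twist programme per lens NODE §8: 58 twists = 38 obstructed by
congruences + 16 of shape u⁴+βv⁴=w⁴ (12 cl -/
@[route_item "route-ABC-RootDecompG"]
def KummerQuarticRung23 : Prop :=
  ∀ a b c : ℕ, Literature.NumberTheory.DiophantineGeometry.IsABCTriple a b c → (∀ p ∈ (a * b * c).primeFactors, ¬ 4 ∣ (a * b * c).factorization p → p ∈ ({2, 3} : Finset ℕ)) → c ≤ 9

/-- item stmt-ABC-28106 · aside · rank 9 · open · by planner
why it might fail: cannot (kernel theorem mod roth, itself proved in the tree as roth_holds); the content beyond it is UNIFORMITY in (u, v) = PolyRothPair (IDEA-NEEDED; print has only the counting version, Bombieri–Gubler Remark 6.2.4 / §6.5.3, and abc ⟹ it, Thm 12.2.9 / Remark 12.2.10).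
sources: BombieriGubler2006, Bugeaud2004, EvertseGyory2015
[aside · rung of the residual LopKummerCell4 · PROVED in the kernel modulo the tree fact `roth`
(abc.S13; `lopKummerRothRung4_of_roth : roth → LopKummerRothRung4`; unconditional as `… roth_holds`
once the farm builds the Roth chain) · restriction of LopKummerCell4
(`lopKummerRothRung4_of_lopKummerCell4`)] for every k ≥ 3 and every coefficient pair u, v > 0:
abc(1+ε), for every ε > 2/k, on the cell's triples (a, v·y^k, u·z^k) with a ≤ c^{1−ε} — the lens
dictionary: a ≤ c^{1−ε} ⟺ |(v/u)^{1/k} − z/y| ≲ y^{−kε}, Roth at exponent 2 + 1/r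
(power_binomial_lower_bound: y^{(k−2)r−1} ≤ N·(u z^k − v y^k)^r) makes the locus finite. Contains
Reyssat's 2 + 3¹⁰·109 = 23⁵ (k = 5, u = 1, v = 109). ‖ writer decomp-abc-writer-1-g2: lens-6 g5
aside (banked, never staffed); PROVED in the lens kernel modulo the tree fact `roth`
(lopKummerRothRung4_of_roth; Reyssat ∈ R(5;1,109) decided); critic CLEARED l.278 «aside PROVED mod
roth»; standalone Theorems-ready file HOME/decomp-abc-lens-6/g5/pkg/KummerProximityRothRung.lean
(rc0) = prover lane / BC5-type witness for LopKummerCell4. -/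
@[route_item "route-ABC-RootDecompG"]
def LopKummerRothRung4 : Prop :=
  ∀ k u v : ℕ, 3 ≤ k → 0 < u → 0 < v → ∀ K : ℕ, ∀ ε : ℝ, 2 / (k : ℝ) < ε → ∃ C : ℝ, 0 < C ∧ ∀ a b c y z : ℕ, Literature.NumberTheory.DiophantineGeometry.IsABCTriple a b c → c ≤ K * ((a * b * c).primeFactors.filter (fun p => ¬ 4 ∣ (a * b * c).factorization p)).prod (fun p => p) ^ 5 → b = v * y ^ k → c = u * z ^ k → (a : ℝ) ≤ (c : ℝ) ^ (1 - ε) → (c : ℝ) < C * ((Literature.NumberTheory.DiophantineGeometry.rad a b c : ℕ) : ℝ) ^ (1 + ε)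

/-- item stmt-ABC-28680 · aside · rank 9 · open · by planner
sources: BakerWustholz1993, corpus:book:baker2007 ch.7, corpus:book:evertse2015 p.12, Literature/Barriers/ABC/BakerMethodBoundsBakerWustholz.lean
[aside · DECIDED RUNG under the residual LopKummerCell4 (stmt-ABC-28097) · PROVED modulo the tree
fact `Literature.Barriers.ABC.baker_wustholz ℚ`:
`Summit.ABC.ABC.Theses.KummerUnitCorner.lopKummerBakerRung4_of_bakerWustholz`; `Iff.rfl` to the
file's `LopKummerBakerRung 4 5`] abc with exponent 1+ε, every ε > 0, for the lopsided (a ≤ c^{1−ε})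
abc triples of the Kummer cell {c ≤ K·N₄(abc)⁵} of the shape a + v·y^k = u·z^l whose generators are
bounded, u,v,y,z ≤ H₀, over ALL exponent pairs (k,l) — the Baker/S-unit rung (complements the Roth
rung stmt-ABC-28106: Roth = fixed coefficients, k = l, growing bases; Baker = bounded bases, free
exponents). Why it might fail: cannot fail: it is Baker–Wüstholz 1993 applied to Λ = log u − log v +
l·log z − k·log y = log(c/b) ∈ (0, 2c^{−ε}] (kernel proof); the only exposure is the tree fact
`baker_wustholz` being mis-typed. Kernels (Summit.ABC.ABC.Theses.KummerUnitCorner, file a4172ece…):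
restriction lopKummerBakerRung4_of_lopKummerCell4 : RootDecompG.LopKummerCell4 →
LopKummerBakerRung4; proof lopKummerBakerRung4_of_bakerWustholz : baker_wustholz ℚ →
LopKummerBakerRung4 [filed by writer decomp-abc-writer-1 g3 per lens-6 g6 KummerUnitCorner (NODE H -/
@[route_item "route-ABC-RootDecompG"]
def LopKummerBakerRung4 : Prop :=
  ∀ H₀ K : ℕ, ∀ ε : ℝ, 0 < ε → ∃ C : ℝ, 0 < C ∧ ∀ a b c k l u v y z : ℕ, Literature.NumberTheory.DiophantineGeometry.IsABCTriple a b c → c ≤ K * ((a * b * c).primeFactors.filter (fun p => ¬ 4 ∣ (a * b * c).factorization p)).prod (fun p => p) ^ 5 → b = v * y ^ k → c = u * z ^ l → 0 < k → 0 < l → 2 ≤ y → 2 ≤ z → u ≤ H₀ → v ≤ H₀ → y ≤ H₀ → z ≤ H₀ → (a : ℝ) ≤ (c : ℝ) ^ (1 - ε) → (c : ℝ) < C * ((Literature.NumberTheory.DiophantineGeometry.rad a b c : ℕ) : ℝ) ^ (1 + ε)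

/-- item stmt-ABC-28681 · aside · rank 9 · open · by planner
sources: corpus:paper:arxiv-math_0312440 p.2, corpus:paper:doi-10-1007-978-1-4612-2116-6-19 pp.7-8, galaxy:panama:490287696707622 pp.208-209, Lang1978ECDA pp.212-217
[support/aside LEAF under the residual LopKummerCell4 (stmt-ABC-28097) · tag WEAKER-by-placement (S
⇒ U4 and PowerLossPillai ⇒ U4 PROVED; PowerLossPillai ⟸ the m = 4 archimedean Lang–Waldschmidt
conjecture PROVED), strictness UNDECIDED, IDEA-NEEDED · `Iff.rfl` to the file's `UnitCornerCell 4
5`] abc with exponent 1+ε, with SOME η = η(ε) > 0, for the lopsided cell triples a + v·y^k = u·z^l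
(k,l ≥ 1, y,z ≥ 2) of generator height k·l·u·v·y·z ≤ c^η. Certified: Lop4 ⇒ U4 (restriction), U4 ⇒
LopKummerBakerRung4 (every H₀). NOT a split child: its complement in Lop4 is Lop4 again by the
export lemma (NODE-g6.md §3). Why it might fail: as typed it follows from abc (kernel), so it fails
only if abc fails on bounded-height S-unit corners; the risk is vacuity of CONTENT, not falsity: for
bounded generators it is the decided Baker rung, and the only statement between it and print is the
Pillai power-loss floor (Lang–Waldschmidt strength), which requires beating BakerMethodBounds
head-on. Kernels (Summit.ABC.ABC.Theses.KummerUnitCorner, file a4172ece…): kernels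
unitCornerCell4_of_lopKummerCell4, unitCornerCell4_of_powerLossPillai, unitCornerCell4_of_abc,
lopKummerBakerRung4_of_unitCornerCell4, p -/
@[route_item "route-ABC-RootDecompG"]
def UnitCornerCell4 : Prop :=
  ∀ K : ℕ, ∀ ε : ℝ, 0 < ε → ∃ η : ℝ, 0 < η ∧ ∃ C : ℝ, 0 < C ∧ ∀ a b c k l u v y z : ℕ, Literature.NumberTheory.DiophantineGeometry.IsABCTriple a b c → c ≤ K * ((a * b * c).primeFactors.filter (fun p => ¬ 4 ∣ (a * b * c).factorization p)).prod (fun p => p) ^ 5 → b = v * y ^ k → c = u * z ^ l → 0 < k → 0 < l → 2 ≤ y → 2 ≤ z → ((k * l * u * v * y * z : ℕ) : ℝ) ≤ (c : ℝ) ^ η → (a : ℝ) ≤ (c : ℝ) ^ (1 - ε) → (c : ℝ) < C * ((Literature.NumberTheory.DiophantineGeometry.rad a b c : ℕ) : ℝ) ^ (1 + ε)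

/-- item stmt-ABC-29653 · aside · rank 9 · open · by planner
[aside — EQUIV reformulation of the residual, same species] EQUIV reformulation of the residual mod
the floor 27123/27138 — same species, score 0; deep corner decorative (R-SHELL); filed to redirect
attacks to the shell. abc(1+ε) ∀ε on the Kummer cell {c ≤ K·N₄(abc)⁵} triples in the proximity SHELL
√c ≤ min(a,b) ≤ c^{1−ε} (ε ≤ λ ≤ ½). KummerFloor4 → ShellKummerCell4 → LopKummerCell4 (kernel
lopKummerCell4_of_shellKummerCell4, τ-descent: τ(m,M,c) = (m(2M+m), M², c²), one squaring halves λ);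
converse shellKummerCell4_of_lopKummerCell4 trivial. The deep corner min(a,b) < √c (a = 1 families,
Reyssat/Catalan/Pillai-type) is DECORATIVE. why it might fail: it is the residual (abc-in-waiting on
the shell); sources: folklore transfer identity (b−a)²+4ab=(a+b)², lens-6 g7 KummerProximityShell. -/
@[route_item "route-ABC-RootDecompG"]
def ShellKummerCell4 : Prop :=
  ∀ K : ℕ, ∀ ε : ℝ, 0 < ε → ∃ C : ℝ, 0 < C ∧ ∀ a b c : ℕ, Literature.NumberTheory.DiophantineGeometry.IsABCTriple a b c → c ≤ K * ((a * b * c).primeFactors.filter (fun p => ¬ 4 ∣ (a * b * c).factorization p)).prod (fun p => p) ^ 5 → ((min a b : ℕ) : ℝ) ≤ (c : ℝ) ^ (1 - ε) → (c : ℝ) ^ (1 / 2 : ℝ) ≤ ((min a b : ℕ) : ℝ) → (c : ℝ) < C * ((Literature.NumberTheory.DiophantineGeometry.rad a b c : ℕ) : ℝ) ^ (1 + ε)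

/-- item stmt-ABC-30978 · aside · rank 9 · open · by planner
why it might fail: As a statement it is implied by ABC (kernel), so it fails only if abc fails on a lopsided, crowded, Kummer-generic triple; as a ROAD it has none: no engine bites cells that exclude smooth/lone/bounded-shape members, and for κ ≥ 1.5 the hit tables are empty (R-EMPTY hazard inherited from 30330).
sources: lens-4 g9 OrphanCore.lean + NODE-g9.md (decomp-abc bus), StewartYu2001, Baker2004abc, doi:10.1017/cbo9780511618314 §7.1 (ψ(x,y))
[aside · COMMON RESIDUAL SPECIES of the root doors · tag of record HONEST-NEGATIVE-mod-∀-families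
(BE, LopFew)] abc, FORGIVEN as door I (factor ∏_{p ≤ rad^ε} p^{(v_p − ⌈1/ε⌉)⁺}), on the ORPHAN CELL
{c ≤ K·N₅(abc)⁴ ∧ c ≤ K·N₄(abc)⁵ ∧ min(a,b) ≤ c^{1−ε} ∧ every member has ≥ 2 primes > (log c)^κ} (∀K
∀ε>0 ∃κ ∃C). KERNEL (lens-4 g9 OrphanCore.lean ebdf3ca86b9c…, 0 sorry, std axioms): implied by EACH
live residual — B LopKummerCell5 (28112), G LopKummerCell4 (28097), K CrowdedMembersFloorABC
(30330), I DeepTameForgivenABC (29234) — and by ABC; conversely with the doors' STRUCTURED pieces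
(KummerFloor5, KummerFloor4, BalKummerCell5, SmoothMemberCellsABC, LoneLargePrimeCellsABC,
DeepTameHeavyABC) it implies ABC (abc_of_pieces_of_orphanCore): the doors jointly reduce abc to
exactly this. POPULATED: 3 kernel witnesses at K=1, κ=1 (q ≈ 1.187, 1.154 at ε=1/20; q ≈ 1.358 at
ε=1/60), 99 census hits at ε=1/20 (c up to 10^63); B/G residuals strictly larger (Reyssat, kernel);
A's live residual 27608 disjoint. ≡ S: UNDECIDED (critic l.493: no identity CERTIFIES membership of
its image in the cell — N_sf / N₅ / N₄ of the fresh factor bounded only from below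
(transport-blindness); crowdedness of the -/
@[route_item "route-ABC-RootDecompG"]
def OrphanCore : Prop :=
  ∀ K : ℕ, ∀ ε : ℝ, 0 < ε → ∃ κ : ℝ, ∃ C : ℝ, 0 < C ∧ ∀ a b c : ℕ, Literature.NumberTheory.DiophantineGeometry.IsABCTriple a b c → c ≤ K * ((a * b * c).primeFactors.filter (fun p => ¬ 5 ∣ (a * b * c).factorization p)).prod (fun p => p) ^ 4 → c ≤ K * ((a * b * c).primeFactors.filter (fun p => ¬ 4 ∣ (a * b * c).factorization p)).prod (fun p => p) ^ 5 → ((min a b : ℕ) : ℝ) ≤ (c : ℝ) ^ (1 - ε) → 2 ≤ (a.primeFactors.filter (fun p : ℕ => Real.log (c : ℝ) ^ κ < (p : ℝ))).card → 2 ≤ (b.primeFactors.filter (fun p : ℕ => Real.log (c : ℝ) ^ κ < (p : ℝ))).card → 2 ≤ (c.primeFactors.filter (fun p : ℕ => Real.log (c : ℝ) ^ κ < (p : ℝ))).card → (c : ℝ) < C * ((∏ p ∈ (a * b * c).primeFactors with p ≤ ⌊((Literature.NumberTheory.DiophantineGeometry.rad a b c : ℕ) : ℝ) ^ ε⌋₊,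 p ^ ((a * b * c).factorization p - ⌈ε⁻¹⌉₊) : ℕ) : ℝ) * ((Literature.NumberTheory.DiophantineGeometry.rad a b c : ℕ) : ℝ) ^ (1 + ε)

/-- item stmt-ABC-31619 · aside · rank 9 · open · by planner
why it might fail: As LopFew5: bounded ω and lopsidedness leave the Stewart–Yu exponential bound log c ≪ rad^{1/3+o(1)}; the N₄ ceiling controls c only through the exponents ≢ 0 mod 4.
sources: StewartYu2001 Thm 1, Literature.Barriers.ABC.BakerMethodBounds, lens-3 g10 KummerOmegaTransport §2, lens-3 g10 children10.json 4c5746d2… (decomp-abc bus l.517/l.530)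
[crux · door G twin of LopFew5] for every K and n: abc(1+ε) on the triples with c ≤ K·N₄(abc)⁵
(Kummer-4 ceiling), min(a,b) ≤ c^(1−ε), ω(abc) ≤ n. Same attack class as LopFew5 (bounded-ω lopsided
LFL square + ceiling). TAGS: WEAKER (ABC → it; BC7 CLEAN) · UNDECIDED · ATTACKABLE/INSTRUMENTABLE ·
no T_k transport (LopFewTop → LopFew4 only) ▶ CRITIC (CLEARED crit-1-g2 STATUS l.530; tribunal
pre-check exact/NEC/≤1-EQUIV/DISTRIBUTED/R-EMPTY/R-TRANSPORT ✓): THIN ∀n bounded-ω piece of G's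
lopsided residual 28097 — WEAKER · UNDECIDED · GENUINE only as the ∀n family (each fixed-n
truncation's complement ≡ the species, kummerOmega_const) · ATTACKABLE/INSTRUMENTABLE (θ=0 road only
lens-3 g9 §5 lopFew_quasiPoly; Stewart–Yu (1/3,3) inside BakerMethodBounds) · populated (1+8=9,
1+80=81, 3+125=128) · no T_k transport into bounded ω. KERNEL: lens-3 g10 KummerOmegaTransport.lean
(7eb453eabc093740…, 1446 l) + ChildrenSelftest.lean (0b6c0a52166d3877…, tree imports only;
glueB/glueG/glueTop PROVED, exactB/exactG/lopsided_iff_children) — lens + critic + writer lean_check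
rc0 · 0 err · 0 warn · 0 sorry · axioms std; BC7 6/6 CLEAN; texts == ChildrenSelftest defs verbatim
(writer python True). SPECIES ATO -/
@[route_item "route-ABC-RootDecompG"]
def LopFew4 : Prop :=
  ∀ K : ℕ, ∀ n : ℕ, ∀ ε : ℝ, 0 < ε → ∃ C : ℝ, 0 < C ∧ ∀ a b c : ℕ, Literature.NumberTheory.DiophantineGeometry.IsABCTriple a b c → c ≤ K * ((a * b * c).primeFactors.filter (fun p => ¬ 4 ∣ (a * b * c).factorization p)).prod (fun p => p) ^ 5 → ((min a b : ℕ) : ℝ) ≤ (c : ℝ) ^ (1 - ε) → (a * b * c).primeFactors.card ≤ n → (c : ℝ) < C * ((Literature.NumberTheory.DiophantineGeometry.rad a b c : ℕ) : ℝ) ^ (1 + ε)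

/-- item stmt-ABC-31620 · aside · rank 9 · open · by planner
why it might fail: As LopTail5: the ω → ∞ lopsided regime under a Kummer ceiling; no ω-uniform method; ≡ the ⊤ tail modulo the open floor 27123.
sources: StewartYu2001 Thm 1, lens-3 g10 KummerOmegaTransport §6b (lopTail4_iff_top'), lens-3 g9 NODE-g9.md §D.1, lens-3 g10 children10.json 4c5746d2… (decomp-abc bus l.517/l.530)
[crux · door G twin of LopTail5] for every K, ε there are n(K,ε), C with abc(1+ε) on the triples
with c ≤ K·N₄(abc)⁵, min(a,b) ≤ c^(1−ε), ω(abc) > n. Modulo KummerFloor4High (⟸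
RootDecompG.KummerFloor4, stmt-ABC-27123) ≡ LopTailTop; modulo both high floors ≡ LopTail5 (kernel).
TAGS: WEAKER (ABC → it; BC7 CLEAN) · UNDECIDED · DECLARED RESIDUAL (IDEA-NEEDED) · ≡ LopTailTop mod
KummerFloor4[27123], ≡ LopTail5 mod both high floors (kernel) ▶ CRITIC (CLEARED crit-1-g2 STATUS
l.530; tribunal pre-check exact/NEC/≤1-EQUIV/DISTRIBUTED/R-EMPTY/R-TRANSPORT ✓): ∃-guarded ω-TAIL of
G's lopsided residual 28097 — WEAKER · UNDECIDED · DECLARED RESIDUAL (ω side) · order-protected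
(R-OMEGA atom does not bite) · IDEA-NEEDED · ≡ LopTailTop ≡ LopTail5 mod the high floors (kernel) ·
populated at every finite n; exact 28097 ⟺ BalKummerCell4-free: LopKummerCell4 ↔ LopFew4 ∧ LopTail4
(lopKummerCell4_iff_children). KERNEL: lens-3 g10 KummerOmegaTransport.lean (7eb453eabc093740…, 1446
l) + ChildrenSelftest.lean (0b6c0a52166d3877…, tree imports only; glueB/glueG/glueTop PROVED,
exactB/exactG/lopsided_iff_children) — lens + critic + writer lean_check rc0 · 0 err · 0 warn · 0
sorry · axioms std; BC7 6/6 CLEAN; -/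
@[route_item "route-ABC-RootDecompG"]
def LopTail4 : Prop :=
  ∀ K : ℕ, ∀ ε : ℝ, 0 < ε → ∃ n : ℕ, ∃ C : ℝ, 0 < C ∧ ∀ a b c : ℕ, Literature.NumberTheory.DiophantineGeometry.IsABCTriple a b c → c ≤ K * ((a * b * c).primeFactors.filter (fun p => ¬ 4 ∣ (a * b * c).factorization p)).prod (fun p => p) ^ 5 → ((min a b : ℕ) : ℝ) ≤ (c : ℝ) ^ (1 - ε) → n < (a * b * c).primeFactors.card → (c : ℝ) < C * ((Literature.NumberTheory.DiophantineGeometry.rad a b c : ℕ) : ℝ) ^ (1 + ε)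

/-- item stmt-ABC-27126 · assembly · rank 1 · closed · proved by Summit.ABC.ABC.Theorems.rootDecompG_assembly_proof (prover) · by planner
sources: BombieriGubler2006
[assembly] KummerFloor4 → KummerFloorCell4 → ABC (the floor puts every triple in the cell K = C₀;
the cell piece is abc there). -/
@[route_item "route-ABC-RootDecompG"]
def Assembly : Prop :=
  KummerFloor4 → KummerFloorCell4 → _root_.ABC

-- `Assembly` holds: proved by `Summit.ABC.ABC.Theorems.rootDecompG_assembly_proof` (its module imports this route file, so no `_holds` link can be stated here).

/-! D-0027 §2.1 — DECIDING THEOREM (planner-authored via `route open/edit --closes-file`; by planner-decomp-abc-writer-1-g0-0 2026-08-30T03:55:05Z):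
its hypotheses are this route's items and its conclusion the sub-problem Statement (glue_lint), and it elaborates with this file. -/

@[closes "route-ABC-RootDecompG"] theorem closes (hF : KummerFloor4) (hC : KummerFloorCell4) : _root_.ABC := by
  rw [_root_.ABC_iff]
  intro ε hε
  obtain ⟨C₀, hF⟩ := hF
  obtain ⟨C, hC0, hb⟩ := hC C₀ ε hε
  exact ⟨C, hC0, fun a b c ht => hb a b c ht (hF a b c ht)⟩

end Summit.ABC.ABC.Theses.RootDecompG
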